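import Mathlib
import HarnessLib
import Literature.Analysis.FluidPDE.WholeSpaceIBP

/-!
# Route `PoloidalWindowDoor`, crux `PoloidalWindowRigidity` (stmt-19708), LINE 9 `sonic_cut` / LINE 8 `riesz_collapse`: the LIMITING STEP of the
# null-Lagrangian collapse, reusable — a signed continuous density with `O(1/R)` cut-off masses vanishes

Seat ns-poloidal-K2-p2 g10 (LEAD-lineage on 19708; file `--supports`).  This is the last step of R1 (`…RieszCollapse.stub_rieszCollapse`, p650966)
isolated for T1 `stub_pairingCollapse` (whose `Q₃` keeps a sign by hypothesis, either one): if `f : ℝ³ → ℝ` is continuous, `f ≥ 0` everywhere or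
`f ≤ 0` everywhere, and `|∫ cutoff R · f| ≤ M/R` for every `R > 0` (the tree cut-off of `Literature…WholeSpaceIBP`: `= 1` on `B̄_R`, `≥ 0`,
compact support), then `f ≡ 0` (`eq_zero_of_sign_of_abs_integral_cutoff_mul_le`): `|∫_{B_r} f| ≤ M/R → 0`, ball integrals vanish, `f = 0` a.e.
(`setIntegral_eq_zero_iff_of_nonneg_ae`), everywhere by continuity (`Measure.eqOn_open_of_ae_eq`).

WHAT THIS IS NOT: pure measure theory; no statement about Navier–Stokes (bears_on LADDER-NS N0 via crux 19708, LINE 9 T1). [folklore]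
-/

noncomputable section

-- the summit and its single sub-problem share the name (CONVENTIONS §1), as in every Theorems file
set_option linter.dupNamespace false

namespace Summit.NavierStokesRegularity.NavierStokesRegularity.Theorems.PoloidalWindowDoorPoloidalWindowRigiditySignedCollapse

open MeasureTheory Set Function Filter Topology Metric
open Literature.Analysis Literature.Analysis.FluidPDE

/-- **Non-negative densities with `O(1/R)` cut-off masses vanish**: `g` continuous, `g ≥ 0`, `|∫ cutoff R · g| ≤ M/R` for all `R > 0`
⇒ `g ≡ 0`. [folklore] -/
theorem eq_zero_of_nonneg_of_abs_integral_cutoff_mul_le {g : EuclideanSpace ℝ (Fin 3) → ℝ} (hg : Continuous g)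
    (hg0 : ∀ y, 0 ≤ g y) {M : ℝ}
    (hgM : ∀ R : ℝ, 0 < R → |∫ x, cutoff (E := EuclideanSpace ℝ (Fin 3)) R x * g x| ≤ M / R) : ∀ y, g y = 0 := by
  have hgi : ∀ r : ℝ, IntegrableOn g (ball (0 : EuclideanSpace ℝ (Fin 3)) r) := fun r =>
    (hg.continuousOn.integrableOn_compact (isCompact_closedBall 0 r)).mono_set ball_subset_closedBall
  -- every ball integral vanishes
  have hball : ∀ r : ℝ, 0 < r → ∫ x in ball (0 : EuclideanSpace ℝ (Fin 3)) r, g x = 0 := by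
    intro r hr
    have hnn : 0 ≤ ∫ x in ball (0 : EuclideanSpace ℝ (Fin 3)) r, g x := setIntegral_nonneg measurableSet_ball fun x _ => hg0 x
    have hup : ∀ R : ℝ, r ≤ R → ∫ x in ball (0 : EuclideanSpace ℝ (Fin 3)) r, g x ≤ M / R := by
      intro R hrR
      have hR : 0 < R := lt_of_lt_of_le hr hrR
      have hφg : Integrable fun x => cutoff (E := EuclideanSpace ℝ (Fin 3)) R x * g x :=
        ((contDiff_cutoff (n := 0) R).continuous.mul hg).integrable_of_hasCompactSupport (hasCompactSupport_cutoff hR).mul_right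
      have h1 : ∫ x in ball (0 : EuclideanSpace ℝ (Fin 3)) r, g x =
          ∫ x in ball (0 : EuclideanSpace ℝ (Fin 3)) r, cutoff (E := EuclideanSpace ℝ (Fin 3)) R x * g x := by
        refine setIntegral_congr_fun measurableSet_ball fun x hx => ?_
        rw [cutoff_eq_one hR ((mem_ball_zero_iff.1 hx).le.trans hrR), one_mul]
      have h2 : ∫ x in ball (0 : EuclideanSpace ℝ (Fin 3)) r, cutoff (E := EuclideanSpace ℝ (Fin 3)) R x * g x ≤
          ∫ x, cutoff (E := EuclideanSpace ℝ (Fin 3)) R x * g x :=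
        setIntegral_le_integral hφg (Eventually.of_forall fun x => mul_nonneg (cutoff_nonneg R x) (hg0 x))
      rw [h1]
      exact h2.trans ((le_abs_self _).trans (hgM R hR))
    refine le_antisymm (le_of_forall_pos_le_add fun ε hε => ?_) hnn
    have hRr : r ≤ max r (M / ε + 1) := le_max_left _ _
    have hRpos : 0 < max r (M / ε + 1) := lt_of_lt_of_le hr hRr
    have hMR : M / max r (M / ε + 1) ≤ ε := by
      rw [div_le_iff₀ hRpos]
      have h1 : M / ε + 1 ≤ max r (M / ε + 1) := le_max_right _ _
      have h2 : M = ε * (M / ε) := by field_simp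
      nlinarith
    linarith [hup _ hRr]
  -- hence `g = 0` a.e. on every ball and, by continuity, everywhere
  intro x
  have hr : 0 < ‖x‖ + 1 := by positivity
  have hae : g =ᵐ[volume.restrict (ball (0 : EuclideanSpace ℝ (Fin 3)) (‖x‖ + 1))] 0 :=
    (setIntegral_eq_zero_iff_of_nonneg_ae (ae_of_all _ fun y => hg0 y) (hgi _)).1 (hball _ hr)
  have hEq := Measure.eqOn_open_of_ae_eq hae isOpen_ball hg.continuousOn continuous_zero.continuousOn
  have hx : x ∈ ball (0 : EuclideanSpace ℝ (Fin 3)) (‖x‖ + 1) := mem_ball_zero_iff.2 (by linarith)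
  simpa using hEq hx

/-- **Signed densities with `O(1/R)` cut-off masses vanish.**  If `f : ℝ³ → ℝ` is continuous, keeps a sign (`f ≥ 0` everywhere or
`f ≤ 0` everywhere) and `|∫ cutoff R · f| ≤ M/R` for every `R > 0`, then `f ≡ 0` — the consuming step for every sign-kept null Lagrangian
of LINE 9 (T1: `Q₃`), after its cut-off masses are bounded. [folklore] -/
theorem eq_zero_of_sign_of_abs_integral_cutoff_mul_le {f : EuclideanSpace ℝ (Fin 3) → ℝ} (hf : Continuous f)
    (hsign : (∀ y, 0 ≤ f y) ∨ (∀ y, f y ≤ 0)) {M : ℝ}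
    (hM : ∀ R : ℝ, 0 < R → |∫ x, cutoff (E := EuclideanSpace ℝ (Fin 3)) R x * f x| ≤ M / R) : ∀ y, f y = 0 := by
  rcases hsign with h | h
  · exact eq_zero_of_nonneg_of_abs_integral_cutoff_mul_le hf h hM
  · -- apply the non-negative case to `−f`
    have hneg := eq_zero_of_nonneg_of_abs_integral_cutoff_mul_le (g := fun y => -f y) hf.neg (fun y => by linarith [h y])
      (M := M) fun R hR => by
        have e : ∫ x, cutoff (E := EuclideanSpace ℝ (Fin 3)) R x * -f x = -∫ x, cutoff (E := EuclideanSpace ℝ (Fin 3)) R x * f x := by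
          rw [← integral_neg]
          exact integral_congr_ae (Eventually.of_forall fun x => by ring)
        rw [e, abs_neg]
        exact hM R hR
    intro y
    have := hneg y
    linarith

end Summit.NavierStokesRegularity.NavierStokesRegularity.Theorems.PoloidalWindowDoorPoloidalWindowRigiditySignedCollapse

end
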